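import Mathlib.Data.Real.Basic
import Mathlib.Tactic.Linarith
import Mathlib.Tactic.LinearCombination
import Mathlib.Tactic.Ring
import Mathlib.Tactic.Positivity
import HarnessLib

/-!
# The two-neighbour reduction for the three-point variance row `(3PT)` — algebraic core

Support file for crux `stmt-CriticalPhenomena-4575` (`NoHeavyLowerTail`), seat `prim-l12-p1` gen 18
(`--supports stmt-CriticalPhenomena-4575`).  Memo `run/shared/lean/prim/prim-l12/FROM-prim-l12-p1-g18-FACET-PRINCIPLE.md` §4.6.

The row `(3PT)`: for bond percolation on a finite weighted graph and vertices `a b c`,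
`P(a↔b)·P(a↮b) ≤ P(exactly two clusters among a, b, c)` (proved ∀n so far only on special classes;
`…ThreePointVarianceTwoNeighbours/CutVertex/BehindCutVertex/Isolation/GladkovRegime(Sum)/GZRegime`).

THE CUBE METHOD (memo §4).  Let `c` have exactly two neighbours `v, w`, joined to `c` with probabilities
`r, ρ`, and let `H = G − c`.  The law of the partition of `{a,b,c}` in `G` is determined by the "state law" of
`H` seen from `{v, w}`: `θ₀ = P_H(a↔b) = p₀ + p₁ + p₂ + p₁₂` (split by which of `v, w` lie in the `ab`-cluster),
and, on `{a↮b}`, the masses `n₀` (neither `v` nor `w` touches the clusters of `a, b`), `u₁` (only `v` does),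
`u₂` (only `w`), `u₁₂` (both, on the same side), `π` (both, on opposite sides — the *crossing* mass).  Then
`P_G(a↔b) = Θ(r,ρ) := θ₀ + π r ρ` and `P_G(exactly two clusters) = Υ(r,ρ) := θ₀ + α r + β ρ + γ₂ r ρ` with
`α = u₁ + u₁₂ + π − p₁ − p₁₂`, `β = u₂ + u₁₂ + π − p₂ − p₁₂`, `γ₂ = p₁₂ − u₁₂ − 2π`, so the `(3PT)` margin of
`G` is `−N(r,ρ)`, `N := Θ(1−Θ) − Υ`.  The four sides of the square `[0,1]²` are the graphs `G − cw`, `G − cv`,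
`G/cv`, `G/cw` (one vertex less), so `(3PT)` for `G` follows from `(3PT)` for those four graphs once one knows

  `FP₀(2)`:  `N ≤ 0` on the boundary of `[0,1]²`  ⟹  `N ≤ 0` on `[0,1]²`.

A maximiser of `N` in the open square is a critical point: `α = κρ`, `β = κr` with
`κ := (1 − 2Θ(r,ρ))·π − γ₂`.  THIS FILE proves the two algebraic facts that settle `FP₀(2)` at such a point
(all masses nonnegative with total mass `≤ 1`, `r, ρ ∈ [0,1]`):

* `crit_le_boundary_of_kappa_nonpos`: if `κ ≤ 0` then `N(r,ρ) ≤ N(1, rρ)` — the boundary point `(1, rρ)` lies on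
  the same level set of `Θ` and beats the critical value (exact identity `N(1,rρ) − N(r,ρ) = −κρ(1−r)²`);
* `crit_nonpos_of_kappa_nonneg`: if `0 ≤ κ` then `N(r,ρ) ≤ 0` (identity `N(r,ρ) = Θ² − 2θ₀Θ − αr` and the mass
  inequality `α ≥ π − θ₀`);
* `fp0_two_core`: the dichotomy `N(r,ρ) ≤ 0 ∨ N(r,ρ) ≤ N(1, rρ)` at every critical point.

Consequence (memo §4.6, paper proof; the graph-side decomposition and the Fermat step on `[0,1]²` are NOT in
this file): if `c` has exactly two neighbours then `(3PT)` for `(a,b,v)`, `(a,b,w)` in `G − c` and for `(a,b,c̃)` in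
`G/cv`, `G/cw` implies `(3PT)` for `(a,b,c)` in `G`; hence a counterexample to `(3PT)` with the fewest vertices
has `deg c ≥ 3`.  This subsumes `…ThreePointVarianceTwoNeighbours` (`N(c) ⊆ {a,b}`).  Everything here is
[this work]; no literature result is restated.
-/

namespace Summit.CriticalPhenomena.PercolationContinuityZ3.Theorems.ThreePointVarianceTwoNeighbourCore

/-- **Boundary comparison when `κ ≤ 0`.**  With `Θ = θ₀ + π r ρ`, `N = Θ(1−Θ) − (θ₀ + αr + βρ + γ₂rρ)` and
`N₁` the same expression at the boundary point `(1, rρ)` (note `Θ(1,rρ) = Θ(r,ρ)`): at a critical point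
(`α = κρ`, `β = κr`) with `κ ≤ 0`, `ρ ≥ 0` one has `N ≤ N₁`; in fact `N₁ − N = −κρ(1−r)²`. [this work] -/
theorem crit_le_boundary_of_kappa_nonpos {θ₀ π α β γ₂ κ r ρ N N₁ : ℝ}
    (hN : N = (θ₀ + π * r * ρ) * (1 - (θ₀ + π * r * ρ)) - (θ₀ + α * r + β * ρ + γ₂ * r * ρ))
    (hN₁ : N₁ = (θ₀ + π * 1 * (r * ρ)) * (1 - (θ₀ + π * 1 * (r * ρ))) -
      (θ₀ + α * 1 + β * (r * ρ) + γ₂ * 1 * (r * ρ)))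
    (hρ0 : 0 ≤ ρ) (hκ : κ ≤ 0)
    (hcrit1 : α = κ * ρ) (hcrit2 : β = κ * r) :
    N ≤ N₁ := by
  have key : N₁ - N = -κ * ρ * (1 - r) ^ 2 := by
    rw [hN, hN₁]
    linear_combination (-(1 - r)) * hcrit1 + (ρ * (1 - r)) * hcrit2
  have hnn : 0 ≤ -κ * ρ * (1 - r) ^ 2 := by
    have h1 : 0 ≤ -κ := by linarith
    have h2 : 0 ≤ (1 - r) ^ 2 := sq_nonneg _
    positivity
  linarith [key, hnn]

/-- **The critical value when `0 ≤ κ`.**  With the state-law masses `p₀ p₁ p₂ p₁₂ u₁ u₂ u₁₂ π ≥ 0` of total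
mass `≤ 1`, `θ₀ = p₀+p₁+p₂+p₁₂`, `α = u₁+u₁₂+π−p₁−p₁₂`, `β = u₂+u₁₂+π−p₂−p₁₂`, `γ₂ = p₁₂−u₁₂−2π`,
`Θ = θ₀ + πrρ`, `κ = (1−2Θ)π − γ₂`, `N = Θ(1−Θ) − (θ₀ + αr + βρ + γ₂rρ)` (`β`, `γ₂` enter only through `κ` and
the criticality relations; in the application `β = u₂+u₁₂+π−p₂−p₁₂`, `γ₂ = p₁₂−u₁₂−2π`): at a point of `[0,1]²` with
`α = κρ`, `β = κr` and `0 ≤ κ`, `N ≤ 0`.  (`N = Θ² − 2θ₀Θ − αr`, and `αr ≥ (π−θ₀)r ≥ πrρ − θ₀ ≥ Θ(Θ−2θ₀)` when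
`Θ > 2θ₀`.) [this work] -/
theorem crit_nonpos_of_kappa_nonneg {p₀ p₁ p₂ p₁₂ u₁ u₂ u₁₂ π θ₀ α β γ₂ κ r ρ Θ N : ℝ}
    (hp₀ : 0 ≤ p₀) (hp₁ : 0 ≤ p₁) (hp₂ : 0 ≤ p₂) (hp₁₂ : 0 ≤ p₁₂) (hu₁ : 0 ≤ u₁) (hu₂ : 0 ≤ u₂)
    (hu₁₂ : 0 ≤ u₁₂) (hπ : 0 ≤ π) (hmass : p₀ + p₁ + p₂ + p₁₂ + u₁ + u₂ + u₁₂ + π ≤ 1)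
    (hθ₀ : θ₀ = p₀ + p₁ + p₂ + p₁₂) (hα : α = u₁ + u₁₂ + π - p₁ - p₁₂)
    (hΘ : Θ = θ₀ + π * r * ρ) (hκdef : κ = (1 - 2 * Θ) * π - γ₂)
    (hN : N = Θ * (1 - Θ) - (θ₀ + α * r + β * ρ + γ₂ * r * ρ))
    (hr0 : 0 ≤ r) (hr1 : r ≤ 1) (hρ0 : 0 ≤ ρ) (hρ1 : ρ ≤ 1) (hκ : 0 ≤ κ)
    (hcrit1 : α = κ * ρ) (hcrit2 : β = κ * r) :
    N ≤ 0 := by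
  -- the critical value `N = Θ² − 2θ₀Θ − αr`
  have hN' : N = Θ ^ 2 - 2 * θ₀ * Θ - α * r := by
    rw [hN]
    linear_combination (-ρ) * hcrit2 + (-(r * ρ)) * hκdef + (1 - 2 * Θ) * hΘ
  rw [hN']
  have hz0 : 0 ≤ r * ρ := mul_nonneg hr0 hρ0
  have hz1 : r * ρ ≤ 1 := by nlinarith
  have hπz : 0 ≤ π * r * ρ := by positivity
  have hπz1 : π * r * ρ ≤ π := by nlinarith [mul_le_mul_of_nonneg_left hz1 hπ]
  have hθ₀0 : 0 ≤ θ₀ := by rw [hθ₀]; linarith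
  have hθπ : θ₀ + π ≤ 1 := by rw [hθ₀]; linarith
  have hΘle : Θ ≤ 1 := by rw [hΘ]; linarith
  have hΘ0 : 0 ≤ Θ := by rw [hΘ]; linarith
  -- `α ≥ π − θ₀` (mass inequality) and `α ≥ 0` (criticality with `κ, ρ ≥ 0`)
  have hαlb : π - θ₀ ≤ α := by rw [hα, hθ₀]; linarith
  have hα0 : 0 ≤ α := by rw [hcrit1]; exact mul_nonneg hκ hρ0
  have hαr : 0 ≤ α * r := mul_nonneg hα0 hr0
  have eΘ : Θ ^ 2 - 2 * θ₀ * Θ = Θ * (Θ - 2 * θ₀) := by ring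
  by_cases hcase : Θ ≤ 2 * θ₀
  · -- `Θ(Θ − 2θ₀) ≤ 0 ≤ α r`
    have hA : Θ * (Θ - 2 * θ₀) ≤ 0 := by
      have := mul_nonneg hΘ0 (by linarith : 0 ≤ 2 * θ₀ - Θ)
      linarith
    linarith
  · -- `π r ρ > θ₀`; `α r ≥ (π − θ₀) r ≥ π r ρ − θ₀ ≥ Θ (Θ − 2 θ₀)`
    have hcase' : 2 * θ₀ < Θ := lt_of_not_ge hcase
    have ew : Θ - 2 * θ₀ = π * r * ρ - θ₀ := by rw [hΘ]; ring
    have hw : 0 ≤ π * r * ρ - θ₀ := by linarith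
    have h2 : (π - θ₀) * r ≤ α * r := mul_le_mul_of_nonneg_right hαlb hr0
    have h3 : π * r * ρ - θ₀ ≤ (π - θ₀) * r := by
      have e3 : (π - θ₀) * r - (π * r * ρ - θ₀) = π * r * (1 - ρ) + θ₀ * (1 - r) := by ring
      have t1 : 0 ≤ π * r * (1 - ρ) := mul_nonneg (mul_nonneg hπ hr0) (by linarith)
      have t2 : 0 ≤ θ₀ * (1 - r) := mul_nonneg hθ₀0 (by linarith)
      linarith
    have h4 : Θ * (Θ - 2 * θ₀) ≤ π * r * ρ - θ₀ := by
      rw [ew]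
      exact mul_le_of_le_one_left hw hΘle
    linarith

/-- **`FP₀(2)` at a critical point (the algebraic core of the two-neighbour reduction).**  For every state law
(masses `≥ 0`, total `≤ 1`) and every point `(r,ρ) ∈ [0,1]²` at which both partial derivatives of the cube
polynomial `N` vanish (`α = κρ`, `β = κr`), either `N(r,ρ) ≤ 0` or `N(r,ρ) ≤ N(1, rρ)` (a value on the
boundary of the square).  Hence `N ≤ 0` on the boundary forces `N ≤ 0` at every interior maximiser, i.e. on the
whole square — which turns `(3PT)` for `G − cv`, `G − cw`, `G/cv`, `G/cw` into `(3PT)` for `G`. [this work] -/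
theorem fp0_two_core {p₀ p₁ p₂ p₁₂ u₁ u₂ u₁₂ π θ₀ α β γ₂ κ r ρ Θ N N₁ : ℝ}
    (hp₀ : 0 ≤ p₀) (hp₁ : 0 ≤ p₁) (hp₂ : 0 ≤ p₂) (hp₁₂ : 0 ≤ p₁₂) (hu₁ : 0 ≤ u₁) (hu₂ : 0 ≤ u₂)
    (hu₁₂ : 0 ≤ u₁₂) (hπ : 0 ≤ π) (hmass : p₀ + p₁ + p₂ + p₁₂ + u₁ + u₂ + u₁₂ + π ≤ 1)
    (hθ₀ : θ₀ = p₀ + p₁ + p₂ + p₁₂) (hα : α = u₁ + u₁₂ + π - p₁ - p₁₂)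
    (hΘ : Θ = θ₀ + π * r * ρ) (hκdef : κ = (1 - 2 * Θ) * π - γ₂)
    (hN : N = Θ * (1 - Θ) - (θ₀ + α * r + β * ρ + γ₂ * r * ρ))
    (hN₁ : N₁ = (θ₀ + π * 1 * (r * ρ)) * (1 - (θ₀ + π * 1 * (r * ρ))) -
      (θ₀ + α * 1 + β * (r * ρ) + γ₂ * 1 * (r * ρ)))
    (hr0 : 0 ≤ r) (hr1 : r ≤ 1) (hρ0 : 0 ≤ ρ) (hρ1 : ρ ≤ 1)
    (hcrit1 : α = κ * ρ) (hcrit2 : β = κ * r) :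
    N ≤ 0 ∨ N ≤ N₁ := by
  rcases le_or_gt 0 κ with hκ | hκ
  · exact Or.inl (crit_nonpos_of_kappa_nonneg hp₀ hp₁ hp₂ hp₁₂ hu₁ hu₂ hu₁₂ hπ hmass hθ₀ hα hΘ hκdef
      hN hr0 hr1 hρ0 hρ1 hκ hcrit1 hcrit2)
  · have hN' : N = (θ₀ + π * r * ρ) * (1 - (θ₀ + π * r * ρ)) - (θ₀ + α * r + β * ρ + γ₂ * r * ρ) := by
      rw [hN, hΘ]
    exact Or.inr (crit_le_boundary_of_kappa_nonpos hN' hN₁ hρ0 hκ.le hcrit1 hcrit2)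

end Summit.CriticalPhenomena.PercolationContinuityZ3.Theorems.ThreePointVarianceTwoNeighbourCore
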